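import Summits.ResolutionOfSingularities.ResolutionOfSingularities.Theorems.EquisingularLiftEquisingularLiftNatTowerBEmbRoundCoreFour
import Summits.ResolutionOfSingularities.ResolutionOfSingularities.Theorems.EquisingularLiftEquisingularLiftNatTowerExceptionalDense
import Summits.ResolutionOfSingularities.ResolutionOfSingularities.Theorems.EquisingularLiftEquisingularLiftNatConeRoundTransport
import Summits.ResolutionOfSingularities.ResolutionOfSingularities.Theorems.EquisingularLiftEquisingularLiftNatCarrierPairStrictTransformRegular
import Summits.ResolutionOfSingularities.ResolutionOfSingularities.Theorems.EquisingularLiftEquisingularLiftNatStrictTransformFlat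
import Summits.ResolutionOfSingularities.ResolutionOfSingularities.Theorems.EquisingularLiftEquisingularLiftNatSubchainSupplierInvSLDefs
import Summits.ResolutionOfSingularities.ResolutionOfSingularities.Theorems.EquisingularLiftEquisingularLiftNatCurveOnSurfaceCartier
import Summits.ResolutionOfSingularities.ResolutionOfSingularities.Theorems.EquisingularLiftEquisingularLiftNatCentreCartierPairFrame
import HarnessLib

/-!
# [OURS · L1 W4.5(b) · EL♮(3) · WIDTH TABLE D4 «HOSTED NOSE» brick D4-3 (HT2)] A HOST LETTER THROUGH A HOSTED ROUND

Desk WIDTH TABLE D4 v0 (2026-08-28), brick D4-3 (res-L1-w45b-stub-4 g11): the second host-transport lemma — the host part of res-L1-w45b-stub-2's `HROUND`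
supplier of K5ʰ (`target_elnat_of_hostedSubchainResolution`).  `--supports stmt-ResolutionOfSingularities-20148`, no claim, counted 0.  AI-produced; NOT a
statement of [Hironaka2017]; EL♮(3) is NOT proved here.

* `TCPlus.letterDatum_transport_hostedRound` — a host letter `E` with explicit model `𝓔`, a round whose centre is PRESENTED ON THE HOST as `𝓔 ⊔ 𝒦₁`
  (trace `𝓘⟨Z⟩`, regular, `O`-flat, `𝒦₁·𝒪_{V(𝓔)}` effective Cartier — the output of ✓ `Tower.hCentre_of_fact_any`), `τ = Bl_{𝓔 ⊔ 𝒦₁}`, `υ₂ = Bl_Z` and a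
  CARTESIAN model square `IsPullback j₂ υ₂ τ jG`: the letter steps to `closure (υ₂⁻¹(E ∖ Z))` at `(X₂, τ ≫ σ)` with model `St_τ 𝓔 ≅ V(𝓔)` — the host
  clauses `ho1`–`ho5` of ✓ `Tower.invB₄_embRoundCore` (A″) in `TCPlus.LetterDatum` currency (`coneRound_exceptional_comap`,
  `subset_closure_diff_of_flat_of_isEffectiveCartier`, `isPrincipal_stalkIdeal_strictTransformIdeal`, `exists_iso_subscheme_strictTransformIdeal_exceptional`,
  `flat_strictTransform_subschemeι_comp_stage`).
* `isPullback_modelSquare_of_comm` — two model squares over `Spec θ` commuting through `τ` give the cartesian square `IsPullback j₂ υ₂ τ jG`.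
* ★ `TCPlus.letterDatum_transport_hostedRound'` — THE SUPPLIER'S SPELLING: centre an ideal sheaf `C ⊇ 𝓔` (regular, `O`-flat, trace `𝓘⟨Z⟩`, 2-frames at its
  support = a relative curve), model squares merely commuting, `𝓔 ≠ ⊥`; Cartier clause by res-L1-w45b-lead-1's `isEffectiveCartier_comap_subschemeι_of_frames`.
-/

set_option linter.dupNamespace false
set_option linter.overlappingInstances false

noncomputable section

open CategoryTheory CategoryTheory.Limits AlgebraicGeometry TopologicalSpace Topology IsLocalRing
open Literature.AlgebraicGeometry.Resolution
open AlgebraicGeometry.Scheme.IdealSheafData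

namespace Summit.ResolutionOfSingularities.ResolutionOfSingularities.Cruxes.EquisingularLiftNat.Sections

section HostRound

variable (O : Type) [CommRing O] [IsDomain O] [IsDiscreteValuationRing O] (k : Type) [Field k] (θ : O →+* k)

/-- **(HT2) A HOST LETTER THROUGH A HOSTED ROUND.**  At a stage `(X, σ)` over `q` with model square `jG : G → X` over `Spec θ`, let `E` be a host letter with
EXPLICIT model `𝓔` (reduced trace `𝓘⟨E⟩`, principal, regular, off `Y`, `O`-flat) and let the round's centre be PRESENTED ON THE HOST as `𝓔 ⊔ 𝒦₁` —
`(𝓔 ⊔ 𝒦₁)·𝒪_G = 𝓘⟨Z⟩`, `V(𝓔 ⊔ 𝒦₁)` regular and `O`-flat, `𝒦₁·𝒪_{V(𝓔)}` an effective Cartier divisor (exactly the output of res-type-027's ✓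
`Tower.hCentre_of_fact_any`, i.e. (T-k) at the host's model).  Then for the blow-up `τ` of `𝓔 ⊔ 𝒦₁`, the blow-up `υ₂` of `𝓘⟨Z⟩` and a model square `j₂`
with `IsPullback j₂ υ₂ τ jG`, the host letter steps to `closure (υ₂⁻¹(E ∖ Z))` at the new stage `(X₂, τ ≫ σ)` with model `St_τ 𝓔`:
trace = `coneRound_exceptional_comap` (density `E ⊆ closure (E ∖ Z)` by `subset_closure_diff_of_flat_of_isEffectiveCartier`), principal =
`isPrincipal_stalkIdeal_strictTransformIdeal`, regular = `exists_iso_subscheme_strictTransformIdeal_exceptional` (`V(St_τ 𝓔) ≅ V(𝓔)`), off `Y` by the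
support, flat = `flat_strictTransform_subschemeι_comp_stage` — the clauses `ho1`–`ho5` of ✓ `Tower.invB₄_embRoundCore` (res-L1-w45b-stub-4, A″) in
`TCPlus.LetterDatum` currency. [cite: GortzWedhorn2020, Prop. 13.91 and 13.96] [OURS · L1 W4.5b · WIDTH TABLE D4 brick D4-3 (HT2)] -/
theorem TCPlus.letterDatum_transport_hostedRound (hθ : Function.Surjective θ) {P X X₂ G G₂ : Scheme.{0}} (q : P ⟶ Spec (.of O)) (Y : Set P)
    (σ : X ⟶ P) [IsLocallyNoetherian X] [IsIntegral X] [IsLocallyNoetherian X₂] (hX : Scheme.IsRegular X)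
    (jG : G ⟶ X) (tG : G ⟶ Spec (.of k)) (hsq : IsPullback jG tG (σ ≫ q) (Spec.map (CommRingCat.ofHom θ)))
    -- the host letter with its model made explicit
    {E : Set G} (hE : IsClosed E) (𝓔 : X.IdealSheafData) (he_i : 𝓔.comap jG = vanishingIdeal ⟨E, hE⟩)
    (he_ii : ∀ z : X, (stalkIdeal 𝓔 z).IsPrincipal) (he_iii : Scheme.IsRegular 𝓔.subscheme)
    (he_iv : σ '' (𝓔.support : Set X) ⊆ {p : P | ¬ IsGenericPoint p Y}) (he_v : Flat (𝓔.subschemeι ≫ σ ≫ q))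
    -- the centre, presented on the host
    (𝒦₁ : X.IdealSheafData) {Z : Set G} (hZ : IsClosed Z) (hc1 : (𝓔 ⊔ 𝒦₁).comap jG = vanishingIdeal ⟨Z, hZ⟩)
    (hc2 : Flat ((𝓔 ⊔ 𝒦₁).subschemeι ≫ σ ≫ q)) (hc3 : Scheme.IsRegular (𝓔 ⊔ 𝒦₁).subscheme)
    (hc4 : IsEffectiveCartier (𝒦₁.comap 𝓔.subschemeι)) (hCne : 𝓔 ⊔ 𝒦₁ ≠ ⊥)
    -- the round and the new model square
    {τ : X₂ ⟶ X} (hτ : IsBlowup τ (𝓔 ⊔ 𝒦₁)) {υ₂ : G₂ ⟶ G} (hυ₂ : IsBlowup υ₂ (vanishingIdeal ⟨Z, hZ⟩))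
    {j₂ : G₂ ⟶ X₂} (hsq₂ : IsPullback j₂ υ₂ τ jG) :
    TCPlus.LetterDatum O P q Y G₂ X₂ (τ ≫ σ) j₂ (closure (υ₂ ⁻¹' (E \ Z))) := by
  have hEZ : E ⊆ closure (E \ Z) := subset_closure_diff_of_flat_of_isEffectiveCartier θ hθ q σ jG tG hsq 𝓔 𝒦₁ hE hZ he_i hc1 hc2 hc4
  have hEc : ((⟨E, hE⟩ : Closeds G) : Set G) ⊆ closure (((⟨E, hE⟩ : Closeds G) : Set G) \ (⟨Z, hZ⟩ : Closeds G)) := hEZ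
  have ho1 : (strictTransformIdeal τ (𝓔 ⊔ 𝒦₁) 𝓔).comap j₂ = vanishingIdeal (⟨closure (υ₂ ⁻¹' (E \ Z)), isClosed_closure⟩ : Closeds G₂) :=
    coneRound_exceptional_comap 𝓔 𝒦₁ hc4 hτ hsq₂ ⟨E, hE⟩ ⟨Z, hZ⟩ he_i hυ₂ hEc
  have ho2 : ∀ z : X₂, (stalkIdeal (strictTransformIdeal τ (𝓔 ⊔ 𝒦₁) 𝓔) z).IsPrincipal := fun z =>
    isPrincipal_stalkIdeal_strictTransformIdeal hX hc3 hτ hCne 𝓔 he_ii z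
  obtain ⟨e𝓔, he𝓔⟩ := exists_iso_subscheme_strictTransformIdeal_exceptional 𝓔 𝒦₁ hc4 hτ
  have ho3 : Scheme.IsRegular (strictTransformIdeal τ (𝓔 ⊔ 𝒦₁) 𝓔).subscheme := Scheme.IsRegular.of_isOpenImmersion e𝓔.hom he_iii
  have ho4 : (τ ≫ σ) '' ((strictTransformIdeal τ (𝓔 ⊔ 𝒦₁) 𝓔).support : Set X₂) ⊆ {p : P | ¬ IsGenericPoint p Y} := by
    rintro _ ⟨z, hz, rfl⟩
    have hz' : z ∈ ((𝓔.comap τ).support : Set X₂) :=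
      Scheme.IdealSheafData.support_antitone (comap_le_strictTransformIdeal τ (𝓔 ⊔ 𝒦₁) 𝓔) hz
    rw [Scheme.IdealSheafData.support_comap] at hz'
    exact he_iv ⟨τ z, hz', rfl⟩
  have ho5 : Flat ((strictTransformIdeal τ (𝓔 ⊔ 𝒦₁) 𝓔).subschemeι ≫ (τ ≫ σ) ≫ q) :=
    flat_strictTransform_subschemeι_comp_stage O σ q τ (𝓔 ⊔ 𝒦₁) hτ 𝓔 he_v
  refine ⟨strictTransformIdeal τ (𝓔 ⊔ 𝒦₁) 𝓔, ?_, ho2, ho3, ho4, ho5⟩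
  rw [ho1]
  congr 1
  exact Closeds.ext closure_closure.symm

omit [IsDomain O] [IsDiscreteValuationRing O] in
/-- **The round's model square is cartesian over the previous one**: two model squares over `Spec θ` (with `θ` surjective, so `Spec θ` is a
monomorphism) commuting through `τ` form a pullback `IsPullback j₂ υ₂ τ jG`. [folklore] -/
theorem isPullback_modelSquare_of_comm (hθ : Function.Surjective θ) {P X X₂ G G₂ : Scheme.{0}} (q : P ⟶ Spec (.of O)) (σ : X ⟶ P)
    (jG : G ⟶ X) (tG : G ⟶ Spec (.of k)) (hsq : IsPullback jG tG (σ ≫ q) (Spec.map (CommRingCat.ofHom θ)))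
    (τ : X₂ ⟶ X) (υ₂ : G₂ ⟶ G) (j₂ : G₂ ⟶ X₂) (t₂ : G₂ ⟶ Spec (.of k))
    (hsq₂ : IsPullback j₂ t₂ ((τ ≫ σ) ≫ q) (Spec.map (CommRingCat.ofHom θ))) (hcomm : j₂ ≫ τ = υ₂ ≫ jG) :
    IsPullback j₂ υ₂ τ jG := by
  haveI : IsClosedImmersion (Spec.map (CommRingCat.ofHom θ)) := IsClosedImmersion.spec_of_surjective _ hθ
  have ht : t₂ = υ₂ ≫ tG := by
    rw [← cancel_mono (Spec.map (CommRingCat.ofHom θ)), Category.assoc, ← hsq.w, ← Category.assoc, ← hcomm, Category.assoc, ← hsq₂.w]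
    simp only [Category.assoc]
  have s : IsPullback j₂ (υ₂ ≫ tG) (τ ≫ σ ≫ q) (Spec.map (CommRingCat.ofHom θ)) := by
    have h := hsq₂; rw [ht, Category.assoc] at h; exact h
  exact IsPullback.of_bot s hcomm hsq

/-- **(HT2′) A HOST LETTER THROUGH A HOSTED ROUND — the supplier's spelling** (inputs as res-L1-w45b-stub-2's `HROUND` assembly has them after ✓
`nestRound_chain_of_fact`): the centre is an ideal sheaf `C ⊇ 𝓔` (i.e. `𝓔 ≤ C`: the lift lies IN the host's model), regular, `O`-flat, with trace `𝓘⟨Z⟩` and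
2-FRAMES at its support (a relative CURVE — from `hFrame_of_ringKrullDim_redSub` and the 1-dimensionality of `Z̃`); the model squares only COMMUTE
through `τ` (the cartesian square is derived, `isPullback_modelSquare_of_comm`); `𝓔 ≠ ⊥`.  The Cartier clause is res-L1-w45b-lead-1's
`isEffectiveCartier_comap_subschemeι_of_frames`; then `TCPlus.letterDatum_transport_hostedRound` at `𝓔 ⊔ C = C`. [OURS · L1 W4.5b · D4-3 (HT2′)] -/
theorem TCPlus.letterDatum_transport_hostedRound' (hθ : Function.Surjective θ) {P X X₂ G G₂ : Scheme.{0}} (q : P ⟶ Spec (.of O)) (Y : Set P)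
    (σ : X ⟶ P) [IsLocallyNoetherian X] [IsIntegral X] [IsLocallyNoetherian X₂] (hX : Scheme.IsRegular X)
    (jG : G ⟶ X) (tG : G ⟶ Spec (.of k)) (hsq : IsPullback jG tG (σ ≫ q) (Spec.map (CommRingCat.ofHom θ)))
    -- the host letter with its model made explicit
    {E : Set G} (hE : IsClosed E) (𝓔 : X.IdealSheafData) (he_i : 𝓔.comap jG = vanishingIdeal ⟨E, hE⟩)
    (he_ii : ∀ z : X, (stalkIdeal 𝓔 z).IsPrincipal) (he_iii : Scheme.IsRegular 𝓔.subscheme)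
    (he_iv : σ '' (𝓔.support : Set X) ⊆ {p : P | ¬ IsGenericPoint p Y}) (he_v : Flat (𝓔.subschemeι ≫ σ ≫ q)) (h𝓔0 : 𝓔 ≠ ⊥)
    -- the centre IN the host's model
    (C : X.IdealSheafData) (h𝓔C : 𝓔 ≤ C) {Z : Set G} (hZ : IsClosed Z) (hCtr : C.comap jG = vanishingIdeal ⟨Z, hZ⟩)
    (hCfl : Flat (C.subschemeι ≫ σ ≫ q)) (hCreg : Scheme.IsRegular C.subscheme)
    (hfr : ∀ x ∈ C.support, ∃ c : Fin 2 → X.presheaf.stalk x, Ideal.span (Set.range c) = stalkIdeal C x ∧ IsQuasiRegular c)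
    -- the round and the new model square
    {τ : X₂ ⟶ X} (hτ : IsBlowup τ C) {υ₂ : G₂ ⟶ G} (hυ₂ : IsBlowup υ₂ (vanishingIdeal ⟨Z, hZ⟩))
    (j₂ : G₂ ⟶ X₂) (t₂ : G₂ ⟶ Spec (.of k)) (hsq₂ : IsPullback j₂ t₂ ((τ ≫ σ) ≫ q) (Spec.map (CommRingCat.ofHom θ)))
    (hcomm : j₂ ≫ τ = υ₂ ≫ jG) :
    TCPlus.LetterDatum O P q Y G₂ X₂ (τ ≫ σ) j₂ (closure (υ₂ ⁻¹' (E \ Z))) := by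
  have h𝓔cart : IsEffectiveCartier 𝓔 := isEffectiveCartier_of_isPrincipal_stalkIdeal_of_ne_bot he_ii h𝓔0
  have hcart : IsEffectiveCartier (C.comap 𝓔.subschemeι) := isEffectiveCartier_comap_subschemeι_of_frames hX 𝓔 C h𝓔C h𝓔cart he_iii hfr
  have hsup : 𝓔 ⊔ C = C := sup_eq_right.mpr h𝓔C
  have hCne : 𝓔 ⊔ C ≠ ⊥ := by rw [hsup]; exact fun h => h𝓔0 (le_bot_iff.mp (h ▸ h𝓔C))
  have hsqP : IsPullback j₂ υ₂ τ jG := isPullback_modelSquare_of_comm O k θ hθ q σ jG tG hsq τ υ₂ j₂ t₂ hsq₂ hcomm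
  exact TCPlus.letterDatum_transport_hostedRound O k θ hθ q Y σ hX jG tG hsq hE 𝓔 he_i he_ii he_iii he_iv he_v C hZ (hsup.symm ▸ hCtr)
    (hsup.symm ▸ hCfl) (hsup.symm ▸ hCreg) hcart hCne (hsup.symm ▸ hτ) hυ₂ hsqP

end HostRound

end Summit.ResolutionOfSingularities.ResolutionOfSingularities.Cruxes.EquisingularLiftNat.Sections

end
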